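import Literature.AlgebraicGeometry.Motives.MixedHodgeStructureCatDualTensor
import Literature.AlgebraicGeometry.Motives.MixedHodgeExtensionTateTwist
import HarnessLib

/-!
# The Tate objects `ℚ(j)` of `MixedHodgeStructureCat`: `ℚ(i)(j) = ℚ(i+j)`, `ℚ(i) ⊗ ℚ(j) ≅ ℚ(i+j)`, `ℚ(j)^∨ ≅ ℚ(−j)`, `X(j) ≅ ℚ(j) ⊗ X` naturally

Layer `Literature/AlgebraicGeometry/Motives` (lane `lit-hodgefound`), continuing `Motives/MixedHodgeStructureCatHodgeClasses` (`tateObj j = ℚ(j)`),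
`…CatTateTwist` (the functor `tateTwist j = (−)(j)`), g45-#14 (`tensorTateIso : ℚ(j) ⊗ X ≅ X(j)`, `unitObj = ℚ(0)`), g45-#15 (`tensorLeft`), g45-#18
(`dualTateTwistIso`, `unitDualIso`).  Deligne, *Hodge II* 2.1.13: «`ℤ(n)` … `ℤ(1)^{⊗n}`; `H(n) = H ⊗ ℤ(n)`»; El Zein–Lê Ex. 3.2.23 (4); Deligne–Milne §1 (the
Tate object of a Tannakian category).  This file records the arithmetic of the Tate objects of the category:

* §1 **`ℚ(i)(j) = ℚ(i+j)`** as OBJECTS (`tateTwist_obj_tateObj`, from the tree's `tate_toMixedHodgeStructure_tateTwist` and `comapEquiv_tateTwist`),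
  `ℚ(j) = ℚ(0)(j)`, the isomorphism `tateObjTwistIso`, and the underlying map of an `eqToHom` (`eqToHom_toLinearMap_apply`);
* §2 the value of `tensorTateHom : ℚ(j) ⊗ X → X(j)` on pure tensors and its NATURALITY; **`tateMulIso i j : ℚ(i) ⊗ ℚ(j) ≅ ℚ(i+j)`**;
* §3 on the finite-dimensional full subcategory: `finTateObj j`, the lifted twist functor **`finTateTwist j`**, and the natural isomorphism
  **`tensorLeftTateIso j : ℚ(j) ⊗ − ≅ (−)(j)`** («`H(n) = H ⊗ ℚ(n)`» functorially);
* §4 **`tateDualIso j : ℚ(j)^∨ ≅ ℚ(−j)`** (`f ↦ f(1)`) and `dualObjFinTateObjIso`.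

Everything is PROVED; no named fact, no instance, no notation.

Sources, verbatim (through the tree's files).  P. Deligne, *Théorie de Hodge II* (1971) [DeligneHodgeII1971], 2.1.13 («`ℤ(1)`… `ℤ(n) = ℤ(1)^{⊗n}`», «`H(n) = H ⊗ ℤ(n)`»),
1.1.6 (dual).  E. Cattani et al. (eds.), *Hodge Theory* (2014) [CattaniElZeinGriffithsLe2014], Ch. 3 Ex. 3.2.23 (4) p. 163 (`ℚ(1)`, `H(r) := H ⊗ ℚ(r)`, `W, F` of the twist),
Def. 3.2.16.  P. Deligne, J. S. Milne, *Tannakian categories* (1982) [DeligneMilne1982Tannakian], §1 (1.7) and Ex. 1.10.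

## Main results

* §1 `eqToHom_toLinearMap_apply`, `tate_toMixedHodgeStructure_tateTwist_add`, **`tateTwist_obj_tateObj`**, `tateObj_eq_tateTwist_obj_unitObj`,
  **`tateObjTwistIso`**, `tateObjTwistIso_hom_toLinearMap_apply`.
* §2 `tensorTateHom_toLinearMap_apply_tmul`, **`tensorTateHom_naturality`**, `tensorTateIso_hom`, **`tateMulIso`**, `tateMulIso_hom_toLinearMap_apply_tmul`.
* §3 `finTateObj`, `finTateObj_zero`, **`finTateTwist`** (`_obj_obj`, `_map_hom`), **`tensorLeftTateIso`**, `tensorLeftTateIso_hom_app_hom`.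
* §4 `tateObj_str_eq_unitObj_str_tateTwist`, **`tateDualIso`**, `tateDualIso_hom_toLinearMap_apply`, **`dualObjFinTateObjIso`**.

## References

* [DeligneHodgeII1971] P. Deligne, Théorie de Hodge II, Publ. Math. IHÉS 40 (1971), 1.1.6, 2.1.13.
* [CattaniElZeinGriffithsLe2014] E. Cattani et al. (eds.), Hodge Theory, Princeton Math. Notes 49 (2014), Ch. 3 Ex. 3.2.23 (4) p. 163, Def. 3.2.16.
* [DeligneMilne1982Tannakian] P. Deligne, J. S. Milne, Tannakian categories, in LNM 900 (1982), §1 (1.7), Ex. 1.10.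

## Provenance

Lane `lit-hodgefound` (summit `HodgeConjecture`), seat `lit-hodgefound-p36` (literature-prover, generation 45, row g45-#19).
-/

noncomputable section

open CategoryTheory CategoryTheory.Limits
open scoped TensorProduct

namespace Literature.AlgebraicGeometry.Motives

universe u

namespace MixedHodgeStructureCat

variable {X Y : MixedHodgeStructureCat.{u}} [Module.Finite ℚ X] [Module.Finite ℚ Y]

/-! ## §1 `ℚ(i)(j) = ℚ(i+j)` -/

/-- The underlying map of `eqToHom (e : A = B)` is the cast along `e` (in particular the identity when the underlying spaces agree definitionally).
[cite: CattaniElZeinGriffithsLe2014, Def. 3.2.16] -/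
theorem eqToHom_toLinearMap_apply {A B : MixedHodgeStructureCat.{u}} (e : A = B) (v : A) :
    (eqToHom e).toLinearMap v = cast (congrArg (fun C : MixedHodgeStructureCat.{u} => (C : Type u)) e) v := by
  subst e
  rfl

/-- **`ℚ(i)(j) = ℚ(i+j)`** as mixed Hodge structures on the line `ℚ` (the tree's `tate_toMixedHodgeStructure_tateTwist`, reindexed).
[cite: CattaniElZeinGriffithsLe2014, Ex. 3.2.23 (4) p. 163] -/
theorem tate_toMixedHodgeStructure_tateTwist_add (i j : ℤ) :
    (HodgeStructure.tate i).toMixedHodgeStructure.tateTwist j = (HodgeStructure.tate (i + j)).toMixedHodgeStructure := by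
  have h := MixedHodgeStructure.tate_toMixedHodgeStructure_tateTwist (-i) j
  rw [neg_neg, show -(-i - j) = i + j by ring] at h
  exact h

/-- **`ℚ(i)(j) = ℚ(i+j)` as OBJECTS of `MixedHodgeStructureCat`.** [cite: CattaniElZeinGriffithsLe2014, Ex. 3.2.23 (4) p. 163] [cite: DeligneHodgeII1971, 2.1.13] -/
theorem tateTwist_obj_tateObj (i j : ℤ) : (tateTwist j).obj (tateObj.{u} i) = tateObj.{u} (i + j) := by
  change of (((HodgeStructure.tate i).toMixedHodgeStructure.comapEquiv uliftRatEquiv.{u}).tateTwist j) =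
    of ((HodgeStructure.tate (i + j)).toMixedHodgeStructure.comapEquiv uliftRatEquiv.{u})
  rw [← MixedHodgeStructure.comapEquiv_tateTwist, tate_toMixedHodgeStructure_tateTwist_add]

/-- `ℚ(j) = ℚ(0)(j)` as objects. [cite: CattaniElZeinGriffithsLe2014, Ex. 3.2.23 (4) p. 163] -/
theorem tateObj_eq_tateTwist_obj_unitObj (j : ℤ) : tateObj.{u} j = (tateTwist j).obj unitObj.{u} := by
  rw [unitObj_eq_tateObj, tateTwist_obj_tateObj, zero_add]

/-- **`ℚ(i)(j) ≅ ℚ(i+j)`** (the identity of the line). [cite: CattaniElZeinGriffithsLe2014, Ex. 3.2.23 (4) p. 163] -/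
def tateObjTwistIso (i j : ℤ) : (tateTwist j).obj (tateObj.{u} i) ≅ tateObj.{u} (i + j) := eqToIso (tateTwist_obj_tateObj i j)

/-- `tateObjTwistIso` is the identity on the line. [cite: CattaniElZeinGriffithsLe2014, Ex. 3.2.23 (4) p. 163] -/
theorem tateObjTwistIso_hom_toLinearMap_apply (i j : ℤ) (q : (tateTwist j).obj (tateObj.{u} i)) :
    (tateObjTwistIso.{u} i j).hom.toLinearMap q = ULift.up q.down := by
  rw [tateObjTwistIso, eqToIso.hom, eqToHom_toLinearMap_apply]
  rfl

/-! ## §2 `ℚ(j) ⊗ X → X(j)` on pure tensors, naturality, `ℚ(i) ⊗ ℚ(j) ≅ ℚ(i+j)` -/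

variable (X) in
/-- **`(q ⊗ x ↦ q • x)`**: the value of `tensorTateHom : ℚ(j) ⊗ X → X(j)` on pure tensors. [cite: DeligneHodgeII1971, 2.1.13] -/
theorem tensorTateHom_toLinearMap_apply_tmul (j : ℤ) (q : tateObj.{u} j) (x : X) :
    haveI := finite_tateObj.{u} j; (tensorTateHom X j).toLinearMap (q ⊗ₜ[ℚ] x) = q.down • x := by
  haveI := finite_tateObj.{u} j
  change (MixedHodgeStructure.tateTensorHom X.str j).toLinearMap
      ((MixedHodgeStructure.Hom.tensorMap (ofTateObj.{u} j) (MixedHodgeStructure.Hom.id X.str)).toLinearMap (q ⊗ₜ[ℚ] x)) = _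
  rw [MixedHodgeStructure.Hom.tensorMap_apply_tmul, MixedHodgeStructure.tateTensorHom_toLinearMap, LinearEquiv.coe_coe, TensorProduct.lid_tmul]
  rfl

/-- **Naturality of `ℚ(j) ⊗ X ≅ X(j)` in `X`**: `(𝟙 ⊗ f) ≫ (ℚ(j) ⊗ Y → Y(j)) = (ℚ(j) ⊗ X → X(j)) ≫ f(j)`. [cite: DeligneHodgeII1971, 2.1.13] -/
theorem tensorTateHom_naturality (j : ℤ) (f : X ⟶ Y) :
    haveI := finite_tateObj.{u} j; tensorHom (𝟙 (tateObj.{u} j)) f ≫ tensorTateHom Y j = tensorTateHom X j ≫ (tateTwist j).map f := by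
  haveI := finite_tateObj.{u} j
  apply hom_ext
  refine TensorProduct.ext' fun q x => ?_
  rw [comp_toLinearMap, LinearMap.comp_apply, tensorHom_toLinearMap_apply_tmul, tensorTateHom_toLinearMap_apply_tmul, comp_toLinearMap,
    LinearMap.comp_apply, tensorTateHom_toLinearMap_apply_tmul, tateTwist_map_toLinearMap]
  exact (f.toLinearMap.map_smul q.down x).symm

variable (X) in
/-- Unfolding `tensorTateIso`. [cite: DeligneHodgeII1971, 2.1.13] -/
theorem tensorTateIso_hom (j : ℤ) : haveI := finite_tateObj.{u} j; (tensorTateIso X j).hom = tensorTateHom X j := rfl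

/-- **`ℚ(i) ⊗ ℚ(j) ≅ ℚ(i+j)`** («`ℤ(n) = ℤ(1)^{⊗n}`»): `ℚ(i) ⊗ ℚ(j) ≅ ℚ(j)(i) = ℚ(j+i) = ℚ(i+j)`. [cite: DeligneHodgeII1971, 2.1.13] [cite: CattaniElZeinGriffithsLe2014, Ex. 3.2.23 (4) p. 163] -/
def tateMulIso (i j : ℤ) : haveI := finite_tateObj.{u} i; haveI := finite_tateObj.{u} j; (tensorObj (tateObj.{u} i) (tateObj.{u} j) ≅ tateObj.{u} (i + j)) :=
  haveI := finite_tateObj.{u} i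
  haveI := finite_tateObj.{u} j
  tensorTateIso (tateObj.{u} j) i ≪≫ tateObjTwistIso j i ≪≫ eqToIso (by rw [add_comm])

/-- `tateMulIso (p ⊗ q) = p q`. [cite: DeligneHodgeII1971, 2.1.13] -/
theorem tateMulIso_hom_toLinearMap_apply_tmul (i j : ℤ) (p : tateObj.{u} i) (q : tateObj.{u} j) :
    haveI := finite_tateObj.{u} i; haveI := finite_tateObj.{u} j; (tateMulIso.{u} i j).hom.toLinearMap (p ⊗ₜ[ℚ] q) = ULift.up (p.down * q.down) := by
  haveI := finite_tateObj.{u} i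
  haveI := finite_tateObj.{u} j
  change MixedHodgeStructure.Hom.toLinearMap (eqToHom (congrArg tateObj.{u} (add_comm j i)))
      ((tateObjTwistIso.{u} j i).hom.toLinearMap ((tensorTateHom (tateObj.{u} j) i).toLinearMap (p ⊗ₜ[ℚ] q))) = _
  rw [tensorTateHom_toLinearMap_apply_tmul, tateObjTwistIso_hom_toLinearMap_apply, eqToHom_toLinearMap_apply]
  rfl

/-! ## §3 On the finite-dimensional subcategory: `ℚ(j) ⊗ − ≅ (−)(j)` -/

/-- `ℚ(j)` as an object of the finite-dimensional full subcategory. [cite: DeligneHodgeII1971, 2.1.13] -/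
def finTateObj (j : ℤ) : FinSubcategory.{u} := ⟨tateObj.{u} j, finite_tateObj.{u} j⟩

/-- Unfolding `finTateObj`. [cite: DeligneHodgeII1971, 2.1.13] -/
theorem finTateObj_obj (j : ℤ) : (finTateObj.{u} j).obj = tateObj.{u} j := rfl

/-- `finTateObj 0 = finUnitObj` (`ℚ(0)` is the unit). [cite: DeligneHodgeII1971, 2.1.13] -/
theorem finTateObj_zero : finTateObj.{u} 0 = finUnitObj.{u} := rfl

/-- **The Tate twist `(−)(j)` on the finite-dimensional full subcategory** (lift of `tateTwist j`; same underlying spaces). [cite: CattaniElZeinGriffithsLe2014, Ex. 3.2.23 (4) p. 163] -/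
def finTateTwist (j : ℤ) : FinSubcategory.{u} ⥤ FinSubcategory.{u} :=
  isFinite.lift (isFinite.ι ⋙ tateTwist j) fun X => (X.property : Module.Finite ℚ X.obj)

/-- Unfolding `finTateTwist` on objects. [cite: CattaniElZeinGriffithsLe2014, Ex. 3.2.23 (4) p. 163] -/
theorem finTateTwist_obj_obj (j : ℤ) (X : FinSubcategory.{u}) : ((finTateTwist j).obj X).obj = (tateTwist j).obj X.obj := rfl

/-- Unfolding `finTateTwist` on morphisms. [cite: CattaniElZeinGriffithsLe2014, Ex. 3.2.23 (4) p. 163] -/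
theorem finTateTwist_map_hom (j : ℤ) {X Y : FinSubcategory.{u}} (f : X ⟶ Y) : ((finTateTwist j).map f).hom = (tateTwist j).map f.hom := rfl

/-- **`ℚ(j) ⊗ − ≅ (−)(j)`** as functors on the finite-dimensional full subcategory («`H(n) = H ⊗ ℤ(n)`», functorially in `H`; components `tensorTateIso`,
naturality `tensorTateHom_naturality`). [cite: DeligneHodgeII1971, 2.1.13] [cite: CattaniElZeinGriffithsLe2014, Ex. 3.2.23 (4) p. 163] -/
def tensorLeftTateIso (j : ℤ) : tensorLeft (finTateObj.{u} j) ≅ finTateTwist j :=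
  NatIso.ofComponents
    (fun X =>
      haveI : Module.Finite ℚ X.obj := X.property
      haveI := finite_tateObj.{u} j
      isFinite.isoMk (tensorTateIso X.obj j))
    (fun {X Y} f => by
      apply isFinite.hom_ext
      haveI : Module.Finite ℚ X.obj := X.property
      haveI : Module.Finite ℚ Y.obj := Y.property
      haveI := finite_tateObj.{u} j
      change tensorHom (𝟙 (tateObj.{u} j)) f.hom ≫ tensorTateHom Y.obj j = tensorTateHom X.obj j ≫ (tateTwist j).map f.hom
      exact tensorTateHom_naturality j f.hom)

/-- The components of `tensorLeftTateIso j` are the `tensorTateIso X j`. [cite: DeligneHodgeII1971, 2.1.13] -/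
theorem tensorLeftTateIso_hom_app_hom (j : ℤ) (X : FinSubcategory.{u}) :
    ((tensorLeftTateIso j).hom.app X).hom =
      haveI : Module.Finite ℚ X.obj := X.property
      haveI := finite_tateObj.{u} j
      tensorTateHom X.obj j := rfl

/-! ## §4 `ℚ(j)^∨ ≅ ℚ(−j)` -/

/-- `ℚ(j) = ℚ(0)(j)` as mixed Hodge structures on the line `ULift ℚ`. [cite: CattaniElZeinGriffithsLe2014, Ex. 3.2.23 (4) p. 163] -/
theorem tateObj_str_eq_unitObj_str_tateTwist (j : ℤ) : (tateObj.{u} j).str = unitObj.{u}.str.tateTwist j := by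
  change (HodgeStructure.tate j).toMixedHodgeStructure.comapEquiv uliftRatEquiv.{u} =
    ((HodgeStructure.tate 0).toMixedHodgeStructure.comapEquiv uliftRatEquiv.{u}).tateTwist j
  rw [← MixedHodgeStructure.comapEquiv_tateTwist, tate_toMixedHodgeStructure_tateTwist_add, zero_add]

/-- **`ℚ(j)^∨ ≅ ℚ(−j)`**: `ℚ(j)^∨ = (ℚ(0)(j))^∨ = ℚ(0)^∨(−j) ≅ ℚ(0)(−j) = ℚ(−j)` (g45-#18 `dualTateTwistIso`, `unitDualIso`). [cite: DeligneHodgeII1971, 1.1.6 and 2.1.13]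
[cite: DeligneMilne1982Tannakian, §1 (1.7)] -/
def tateDualIso (j : ℤ) : haveI := finite_tateObj.{u} j; (of (tateObj.{u} j).str.dual ≅ tateObj.{u} (-j)) :=
  haveI := finite_tateObj.{u} j
  eqToIso (congrArg (fun H : MixedHodgeStructure (ULift.{u} ℚ) => of H.dual) (tateObj_str_eq_unitObj_str_tateTwist.{u} j)) ≪≫
    dualTateTwistIso unitObj.{u} j ≪≫ (tateTwist (-j)).mapIso unitDualIso.{u} ≪≫ eqToIso (tateObj_eq_tateTwist_obj_unitObj.{u} (-j)).symm

/-- `tateDualIso f = f(1)`. [cite: DeligneHodgeII1971, 1.1.6 and 2.1.13] -/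
theorem tateDualIso_hom_toLinearMap_apply (j : ℤ) (f : Module.Dual ℚ (tateObj.{u} j)) :
    haveI := finite_tateObj.{u} j; (tateDualIso.{u} j).hom.toLinearMap f = ULift.up (f (ULift.up 1)) := by
  haveI := finite_tateObj.{u} j
  change MixedHodgeStructure.Hom.toLinearMap (eqToHom (tateObj_eq_tateTwist_obj_unitObj.{u} (-j)).symm)
      (((tateTwist (-j)).map unitDualIso.{u}.hom).toLinearMap ((dualTateTwistIso unitObj.{u} j).hom.toLinearMap
        (MixedHodgeStructure.Hom.toLinearMap
          (eqToHom (congrArg (fun H : MixedHodgeStructure (ULift.{u} ℚ) => of H.dual) (tateObj_str_eq_unitObj_str_tateTwist.{u} j))) f))) = _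
  rw [eqToHom_toLinearMap_apply, tateTwist_map_toLinearMap, dualTateTwistIso_hom_toLinearMap_apply, eqToHom_toLinearMap_apply]
  exact unitDualIso_hom_toLinearMap_apply.{u} f

/-- **`ℚ(j)^∨ ≅ ℚ(−j)` on the finite-dimensional subcategory** (`dualObj (finTateObj j) ≅ finTateObj (−j)`). [cite: DeligneMilne1982Tannakian, §1 (1.7)] -/
def dualObjFinTateObjIso (j : ℤ) : dualObj (finTateObj.{u} j) ≅ finTateObj.{u} (-j) := isFinite.isoMk (tateDualIso.{u} j)

/-- Unfolding `dualObjFinTateObjIso`. [cite: DeligneMilne1982Tannakian, §1 (1.7)] -/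
theorem dualObjFinTateObjIso_hom_hom (j : ℤ) : (dualObjFinTateObjIso.{u} j).hom.hom = (tateDualIso.{u} j).hom := rfl

end MixedHodgeStructureCat

end Literature.AlgebraicGeometry.Motives
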